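/-
Copyright (c) 2026 The H21 project. Released under Apache 2.0 license.
-/
import Summits.RiemannHypothesis.RiemannHypothesis.Theorems.PfPersistenceGalerkinLinearDensity
import Summits.RiemannHypothesis.RiemannHypothesis.Theorems.PfPersistenceGalerkinNegIndex
import HarnessLib

/-!
# `P_F` persistence — GAL-4: the EXACT INDEX LAW for the Galerkin tower (cand-3, gen 11)

Mechanism / rigidity campaign of the `pub-rhpf` cell (variational seat M2 = cand-3); NO claim about RH is made
anywhere in this file.  Everything here is RH-free and sorry-free; no numerical datum is used (all PROVED).

GAL-3 (`PfPersistenceGalerkinNegIndex`) transferred the M2 seat's continuum negative even index INTO the tower: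
`EvenNegIndexAtLeast n a → ∃ N, GalerkinNegIndexAtLeast ζ n (a, N)`.  This file proves the CONVERSE transfer and
hence the exact law.

* §1 `evenNegIndexAtLeast_of_linearScheme` — the finite-dimensional mechanism, abstractly: a negative-definite
  `n`-space `span{vᵢ}` of a window form `D` plus ANY sequence of LINEAR smoothings `T_m` of window vectors into even
  real tests on `[-a, a]` whose forms converge at the `n + n²` sample vectors `vᵢ`, `vᵢ + vⱼ` gives
  `EvenNegIndexAtLeast n a`: by the Gram expansion (`re_weilQuadratic_sum_real`) and linearity, `Re Q` on
  `span{T_m vᵢ}` is the quadratic form of a Gram matrix `B_m`; polarisation turns the sample convergences into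
  convergence of the polar coefficients, hence pointwise convergence `cᵀ B_m c → (∑ cᵢvᵢ)ᵀ D (∑ cᵢvᵢ)`, and
  `eventually_negDef_of_tendsto` (GAL-3 prep.) makes `B_m` negative definite for large `m`.
* §2 `evenNegIndexAtLeast_of_galerkinNegIndexAtLeast` — instantiated with the linear smoothing `linApprox` and
  its simultaneous form control `linApprox_formDense` (`PfPersistenceGalerkinLinearDensity`):
  `GalerkinNegIndexAtLeast ζ n (a, N) → EvenNegIndexAtLeast n a`.  With GAL-3:
  `EvenNegIndexAtLeast n a ↔ ∃ N, GalerkinNegIndexAtLeast ζ n (a, N)` (`evenNegIndexAtLeast_iff_exists_galerkin`).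
* §3 READINGS through the M2 index theorem (`𝒬 = {ρ : ζ(ρ) = 0, Re ρ > 1/2, Im ρ > 0}`):
  a Galerkin negative `n`-space at ANY window forces `#𝒬 ≥ n` (`le_encard_quadrant_of_galerkinNegIndexAtLeast`);
  `ε₂^{(N)}(a) < 0 ⇒ #𝒬 ≥ 2`, `ε₁^{(N)}(a) < 0 ⇒ #𝒬 ≥ 1`; for `𝒬` finite the EXACT LAW
  `(∃ window with Galerkin negative index ≥ n) ↔ n ≤ #𝒬` and `(no window has Galerkin index ≥ n + 1) ↔ #𝒬 ≤ n`;
  in particular the SECOND Galerkin level is non-negative at every window iff `#𝒬 ≤ 1` (given finiteness) —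
  the Galerkin twin of the M2 census line "the second even level is blind exactly to `K = 1`"; and under RH no
  window carries any Galerkin negative direction.
-/

set_option linter.dupNamespace false

noncomputable section

open Complex Filter Set MeasureTheory Topology Matrix Finset
open scoped Real ComplexConjugate

namespace Summit.RiemannHypothesis.RiemannHypothesis.Theorems.PfPersistence

open Literature.NumberTheory.LFunctions Literature.NumberTheory.LFunctions.WeilContinuous
open Literature.NumberTheory.LFunctions.ZetaZeros
open Summit.RiemannHypothesis.RiemannHypothesis.Theorems.PfPersistenceM2NegIndex

/-! ## §1 The finite-dimensional mechanism -/

/-- PROVED: a combination against a coordinate vector is the coordinate. [folklore] -/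
theorem sum_single_smul {n m : ℕ} (v : Fin n → Fin m → ℝ) (i : Fin n) :
    ∑ l, (Pi.single i (1 : ℝ) : Fin n → ℝ) l • v l = v i := by
  rw [Finset.sum_eq_single i (fun l _ hl ↦ by rw [Pi.single_eq_of_ne hl, zero_smul])
    (fun h ↦ absurd (Finset.mem_univ i) h), Pi.single_eq_same, one_smul]

/-- PROVED: a combination against a sum of two coordinate vectors. [folklore] -/
theorem sum_single_add_single_smul {n m : ℕ} (v : Fin n → Fin m → ℝ) (i j : Fin n) :
    ∑ l, (Pi.single i (1 : ℝ) + Pi.single j 1 : Fin n → ℝ) l • v l = v i + v j := by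
  simp only [Pi.add_apply, add_smul, Finset.sum_add_distrib, sum_single_smul]

/-- **PROVED — THE TRANSFER MECHANISM (abstract).**  Let `span{v₁, …, vₙ}` be negative definite for a window form
`D`, and let `T_m` (`m ∈ ℕ`) be smoothings of window vectors into even, real Weil tests supported in `[-a, a]`,
LINEAR on the combinations of the `vᵢ`, whose forms converge at the sample vectors: `Re Q(T_m vᵢ) → vᵢᵀ D vᵢ` and
`Re Q(T_m (vᵢ + vⱼ)) → (vᵢ + vⱼ)ᵀ D (vᵢ + vⱼ)`.  Then `EvenNegIndexAtLeast n a` (witnessed by `T_m v₁, …, T_m vₙ`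
for one large `m`).  Gram expansion + polarisation + `eventually_negDef_of_tendsto`. RH-free. [folklore] -/
theorem evenNegIndexAtLeast_of_linearScheme {n N : ℕ} {a : ℝ} (D : Matrix (Fin (N + 1)) (Fin (N + 1)) ℝ)
    (v : Fin n → Fin (N + 1) → ℝ)
    (hv : ∀ c : Fin n → ℝ, c ≠ 0 → (∑ i, c i • v i) ⬝ᵥ (D *ᵥ ∑ i, c i • v i) < 0)
    (T : ℕ → (Fin (N + 1) → ℝ) → ℝ → ℂ) (hT : ∀ m u, IsWeilTest (T m u))
    (hTev : ∀ m u (t : ℝ), T m u (-t) = T m u t) (hTim : ∀ m u (t : ℝ), (T m u t).im = 0)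
    (hTsupp : ∀ m u, tsupport (T m u) ⊆ Icc (-a) a)
    (hTlin : ∀ m (c : Fin n → ℝ) (t : ℝ), T m (∑ i, c i • v i) t = ∑ i, (c i : ℂ) * T m (v i) t)
    (hT₁ : ∀ i, Tendsto (fun m ↦ (weilQuadratic (T m (v i))).re) atTop (𝓝 (v i ⬝ᵥ (D *ᵥ v i))))
    (hT₂ : ∀ i j, Tendsto (fun m ↦ (weilQuadratic (T m (v i + v j))).re) atTop
      (𝓝 ((v i + v j) ⬝ᵥ (D *ᵥ (v i + v j))))) :
    EvenNegIndexAtLeast n a := by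
  -- the Gram matrices of the smoothed families and the limit form
  obtain ⟨B, hB⟩ : ∃ B : ℕ → Matrix (Fin n) (Fin n) ℝ, ∀ m, B m = reGram fun i ↦ T m (v i) :=
    ⟨_, fun _ ↦ rfl⟩
  obtain ⟨G, hG⟩ : ∃ G : (Fin n → ℝ) → ℝ, ∀ c, G c = c ⬝ᵥ (formMatrix D v *ᵥ c) := ⟨_, fun _ ↦ rfl⟩
  -- (i) by the Gram expansion and linearity, `cᵀ B_m c = Re Q(T_m (∑ cᵢ vᵢ))`
  have hq : ∀ m (c : Fin n → ℝ), c ⬝ᵥ (B m *ᵥ c) = (weilQuadratic (T m (∑ i, c i • v i))).re := by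
    intro m c
    rw [hB, ← re_weilQuadratic_sum_real (fun i ↦ hT m (v i)) c]
    congr 2
    funext t
    exact (hTlin m c t).symm
  have hGc : ∀ c, G c = (∑ i, c i • v i) ⬝ᵥ (D *ᵥ ∑ i, c i • v i) := fun c ↦ by
    rw [hG, ← form_sum_smul]
  -- (ii) the polar coefficients converge
  have hP : ∀ i j, Tendsto (fun m ↦ polarCoeff (fun x ↦ x ⬝ᵥ (B m *ᵥ x)) i j) atTop
      (𝓝 (polarCoeff G i j)) := by
    intro i j
    have e : ∀ m, polarCoeff (fun x ↦ x ⬝ᵥ (B m *ᵥ x)) i j =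
        ((weilQuadratic (T m (v i + v j))).re - (weilQuadratic (T m (v i))).re -
          (weilQuadratic (T m (v j))).re) / 2 := fun m ↦ by
      simp only [polarCoeff, hq, sum_single_add_single_smul, sum_single_smul]
    have eG : polarCoeff G i j =
        ((v i + v j) ⬝ᵥ (D *ᵥ (v i + v j)) - v i ⬝ᵥ (D *ᵥ v i) - v j ⬝ᵥ (D *ᵥ v j)) / 2 := by
      simp only [polarCoeff, hGc, sum_single_add_single_smul, sum_single_smul]
    simp_rw [e, eG]
    exact (((hT₂ i j).sub (hT₁ i)).sub (hT₁ j)).div_const 2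
  -- (iii) hence the forms converge pointwise
  have hconv : ∀ c, Tendsto (fun m ↦ c ⬝ᵥ (B m *ᵥ c)) atTop (𝓝 (G c)) := by
    intro c
    have eG : G c = ∑ i, ∑ j, c i * c j * polarCoeff G i j := by
      have hfun : (fun x ↦ x ⬝ᵥ (formMatrix D v *ᵥ x)) = G := funext fun x ↦ (hG x).symm
      have h := form_eq_sum_polarCoeff (formMatrix D v) c
      rwa [hfun, ← hG] at h
    have e : ∀ m, c ⬝ᵥ (B m *ᵥ c) = ∑ i, ∑ j, c i * c j * polarCoeff (fun x ↦ x ⬝ᵥ (B m *ᵥ x)) i j :=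
      fun m ↦ form_eq_sum_polarCoeff (B m) c
    rw [eG]
    simp_rw [e]
    exact tendsto_finsetSum _ fun i _ ↦ tendsto_finsetSum _ fun j _ ↦ (hP i j).const_mul _
  -- (iv) the limit is negative definite, so `B_m` is for large `m`
  have hneg : ∀ c, c ≠ 0 → G c < 0 := fun c hc ↦ by
    rw [hGc]
    exact hv c hc
  obtain ⟨m₀, hm₀⟩ := eventually_negDef_of_tendsto B G hconv hneg
  refine ⟨fun i ↦ T m₀ (v i), fun i ↦ hT m₀ (v i), fun i t ↦ hTev m₀ (v i) t, fun i t ↦ hTim m₀ (v i) t,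
    fun i ↦ hTsupp m₀ (v i), fun c hc ↦ ?_⟩
  rw [re_weilQuadratic_sum_real (fun i ↦ hT m₀ (v i)) c, ← hB]
  exact hm₀ m₀ le_rfl c hc

/-! ## §2 The converse transfer and the exact law -/

/-- **PROVED (GAL-4) — A GALERKIN NEGATIVE SPACE IS A CONTINUUM NEGATIVE SPACE.**  If the even block of `ζ` at a
window `(a, N)` is negative definite on an `n`-space of window vectors, then `n` smooth even real Weil tests on
`[-a, a]` span a negative-definite subspace of `Re Q`: `GalerkinNegIndexAtLeast ζ n (a, N) → EvenNegIndexAtLeast n a`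
(same `a`).  The tests are the linear smoothings `linApprox` of the vectors at one common pair of indices, chosen by
`linApprox_formDense` along `δ = 1/(m+1)` on the sample family `{vᵢ} ∪ {vᵢ + vⱼ}`. RH-free. [folklore] -/
theorem evenNegIndexAtLeast_of_galerkinNegIndexAtLeast {n : ℕ} {win : Window}
    (h : GalerkinNegIndexAtLeast zetaDatum n win) : EvenNegIndexAtLeast n win.a := by
  obtain ⟨v, hv⟩ := h
  -- the sample family: singles and pairs
  obtain ⟨w, hw₁, hw₂⟩ : ∃ w : Fin n ⊕ Fin n × Fin n → Fin (win.N + 1) → ℝ,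
      (∀ i, w (Sum.inl i) = v i) ∧ ∀ i j, w (Sum.inr (i, j)) = v i + v j :=
    ⟨Sum.elim v fun p ↦ v p.1 + v p.2, fun _ ↦ rfl, fun _ _ ↦ rfl⟩
  have hd : ∀ m : ℕ, ∃ nk : ℕ × ℕ, (bump nk.2).rOut < win.a - radiusSeq win.a nk.1 ∧
      ∀ l, |(weilQuadratic (linApprox win nk.1 nk.2 (w l))).re - w l ⬝ᵥ (zetaDatum win *ᵥ w l)| ≤
        1 / ((m : ℝ) + 1) := fun m ↦ by
    obtain ⟨n', k, hk, hl⟩ := linApprox_formDense win w (δ := 1 / ((m : ℝ) + 1)) (by positivity)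
    exact ⟨(n', k), hk, hl⟩
  choose nk hnk₁ hnk₂ using hd
  have hlim : ∀ l, Tendsto (fun m ↦ (weilQuadratic (linApprox win (nk m).1 (nk m).2 (w l))).re) atTop
      (𝓝 (w l ⬝ᵥ (zetaDatum win *ᵥ w l))) := fun l ↦ by
    refine tendsto_sub_nhds_zero_iff.1
      (squeeze_zero_norm (fun m ↦ ?_) tendsto_one_div_add_atTop_nhds_zero_nat)
    rw [Real.norm_eq_abs]
    exact hnk₂ m l
  refine evenNegIndexAtLeast_of_linearScheme (zetaDatum win) v hv (fun m ↦ linApprox win (nk m).1 (nk m).2)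
    (fun m u ↦ isWeilTest_linApprox _ _ _ _) (fun m u t ↦ linApprox_neg _ _ _ _ t)
    (fun m u t ↦ linApprox_im _ _ _ _ t) (fun m u ↦ tsupport_linApprox_subset _ _ _ _ (hnk₁ m).le)
    (fun m c t ↦ linApprox_sum_smul _ _ _ c v t) (fun i ↦ ?_) (fun i j ↦ ?_)
  · have h := hlim (Sum.inl i)
    rwa [hw₁] at h
  · have h := hlim (Sum.inr (i, j))
    rwa [hw₂] at h

/-- **PROVED — THE INDEX LAW: continuum and Galerkin negative even indices agree window by window** (GAL-3 + GAL-4):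
`EvenNegIndexAtLeast n a ↔ ∃ N, GalerkinNegIndexAtLeast ζ n (a, N)`. RH-free. [folklore] -/
theorem evenNegIndexAtLeast_iff_exists_galerkin {n : ℕ} {a : ℝ} (ha : 0 < a) :
    EvenNegIndexAtLeast n a ↔ ∃ N : ℕ, GalerkinNegIndexAtLeast zetaDatum n ⟨a, N, ha⟩ :=
  ⟨exists_galerkinNegIndexAtLeast_of_evenNegIndexAtLeast ha,
    fun ⟨_, hN⟩ ↦ evenNegIndexAtLeast_of_galerkinNegIndexAtLeast hN⟩

/-- PROVED: and then at every larger truncation (nesting). [folklore] -/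
theorem evenNegIndexAtLeast_iff_eventually_galerkin {n : ℕ} {a : ℝ} (ha : 0 < a) :
    EvenNegIndexAtLeast n a ↔ ∃ N₀ : ℕ, ∀ N, N₀ ≤ N → GalerkinNegIndexAtLeast zetaDatum n ⟨a, N, ha⟩ := by
  rw [evenNegIndexAtLeast_iff_exists_galerkin ha]
  exact ⟨fun ⟨N₀, h⟩ ↦ ⟨N₀, fun N hN ↦ zeta_galerkinNegIndexAtLeast_mono hN h⟩, fun ⟨N₀, h⟩ ↦ ⟨N₀, h N₀ le_rfl⟩⟩

/-! ## §3 Readings through the M2 index theorem -/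

/-- **PROVED — A GALERKIN NEGATIVE `n`-SPACE AT ANY WINDOW FORCES `n` OFF-LINE QUADRUPLES**:
`GalerkinNegIndexAtLeast ζ n (a, N) → n ≤ #𝒬`. RH-free, no finiteness hypothesis. [folklore] -/
theorem le_encard_quadrant_of_galerkinNegIndexAtLeast {n : ℕ} {win : Window}
    (h : GalerkinNegIndexAtLeast zetaDatum n win) :
    (n : ℕ∞) ≤ {ρ : ℂ | ρ ∈ riemannZetaNontrivialZeros ∧ 1 / 2 < ρ.re ∧ 0 < ρ.im}.encard :=
  le_encard_quadrant_of_evenNegIndexAtLeast (evenNegIndexAtLeast_of_galerkinNegIndexAtLeast h)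

/-- PROVED: a negative SECOND Galerkin level `ε₂^{(N)}(a) < 0` (`N ≥ 1`) at any window forces two off-line
quadruples. RH-free. [folklore] -/
theorem two_le_encard_quadrant_of_secondRayleigh_neg (win : Window) (hN : 0 < win.N)
    (h : secondRayleigh (zetaDatum win) < 0) :
    (2 : ℕ∞) ≤ {ρ : ℂ | ρ ∈ riemannZetaNontrivialZeros ∧ 1 / 2 < ρ.re ∧ 0 < ρ.im}.encard := by
  exact_mod_cast le_encard_quadrant_of_galerkinNegIndexAtLeast ((galerkinNegIndexAtLeast_two_iff win hN).2 h)

/-- PROVED: a negative BOTTOM Galerkin level `ε₁^{(N)}(a) < 0` at any window forces an off-line quadruple.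
RH-free. [folklore] -/
theorem one_le_encard_quadrant_of_bottomRayleigh_neg (win : Window) (h : bottomRayleigh (zetaDatum win) < 0) :
    (1 : ℕ∞) ≤ {ρ : ℂ | ρ ∈ riemannZetaNontrivialZeros ∧ 1 / 2 < ρ.re ∧ 0 < ρ.im}.encard := by
  exact_mod_cast le_encard_quadrant_of_galerkinNegIndexAtLeast ((galerkinNegIndexAtLeast_one_iff _ win).2 h)

/-- PROVED: conversely `#𝒬 ≤ 1` keeps the second Galerkin level non-negative at EVERY window (`N ≥ 1`).
RH-free. [folklore] -/
theorem secondRayleigh_nonneg_of_encard_le_one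
    (h : {ρ : ℂ | ρ ∈ riemannZetaNontrivialZeros ∧ 1 / 2 < ρ.re ∧ 0 < ρ.im}.encard ≤ 1) (win : Window)
    (hN : 0 < win.N) : 0 ≤ secondRayleigh (zetaDatum win) := by
  by_contra hlt
  have h2 := (two_le_encard_quadrant_of_secondRayleigh_neg win hN (not_le.1 hlt)).trans h
  norm_num at h2

/-- **PROVED — THE EXACT LAW FOR THE TOWER** (`𝒬` finite): some window carries a Galerkin negative `n`-space iff
`n ≤ #𝒬`. [folklore] -/
theorem exists_galerkinNegIndexAtLeast_iff_le_card
    (hfin : {ρ : ℂ | ρ ∈ riemannZetaNontrivialZeros ∧ 1 / 2 < ρ.re ∧ 0 < ρ.im}.Finite) (n : ℕ) :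
    (∃ win : Window, GalerkinNegIndexAtLeast zetaDatum n win) ↔ n ≤ hfin.toFinset.card := by
  constructor
  · rintro ⟨win, hwin⟩
    have h := le_encard_quadrant_of_galerkinNegIndexAtLeast hwin
    rw [hfin.encard_eq_coe_toFinset_card] at h
    exact_mod_cast h
  · intro hn
    obtain ⟨A, hA⟩ := evenNegIndexAtLeast_of_finite hfin hn
    have ha : 0 < max A 1 := lt_of_lt_of_le one_pos (le_max_right A 1)
    obtain ⟨N, hN⟩ := exists_galerkinNegIndexAtLeast_of_evenNegIndexAtLeast ha (hA _ (le_max_left A 1))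
    exact ⟨_, hN⟩

/-- PROVED: equivalently, NO window carries a Galerkin negative `(n+1)`-space iff `#𝒬 ≤ n` (`𝒬` finite) — the
hierarchy of Galerkin level-sign statements is exactly the hierarchy `K ≤ n`. [folklore] -/
theorem forall_not_galerkinNegIndexAtLeast_succ_iff
    (hfin : {ρ : ℂ | ρ ∈ riemannZetaNontrivialZeros ∧ 1 / 2 < ρ.re ∧ 0 < ρ.im}.Finite) (n : ℕ) :
    (∀ win : Window, ¬ GalerkinNegIndexAtLeast zetaDatum (n + 1) win) ↔ hfin.toFinset.card ≤ n := by
  have h := exists_galerkinNegIndexAtLeast_iff_le_card hfin (n + 1)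
  constructor
  · intro hno
    by_contra hlt
    obtain ⟨win, hwin⟩ := h.2 (by omega)
    exact hno win hwin
  · intro hle win hwin
    have h2 := h.1 ⟨win, hwin⟩
    omega

/-- **PROVED — THE SECOND GALERKIN LEVEL IS BLIND EXACTLY TO `K = 1`** (`𝒬` finite): `ε₂^{(N)}(a) ≥ 0` at every
window with `N ≥ 1` iff `#𝒬 ≤ 1` — the Galerkin twin of the M2 census line `not_evenNegIndexAtLeast_two_iff`;
strictly weaker than RH. [folklore] -/
theorem forall_secondRayleigh_nonneg_iff_card_le_one
    (hfin : {ρ : ℂ | ρ ∈ riemannZetaNontrivialZeros ∧ 1 / 2 < ρ.re ∧ 0 < ρ.im}.Finite) :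
    (∀ win : Window, 0 < win.N → 0 ≤ secondRayleigh (zetaDatum win)) ↔ hfin.toFinset.card ≤ 1 := by
  constructor
  · intro hno
    refine (forall_not_galerkinNegIndexAtLeast_succ_iff hfin 1).1 fun win hwin ↦ ?_
    obtain ⟨a, N, ha⟩ := win
    have h' : GalerkinNegIndexAtLeast zetaDatum 2 ⟨a, N + 1, ha⟩ :=
      zeta_galerkinNegIndexAtLeast_mono (Nat.le_succ N) hwin
    have hneg := (galerkinNegIndexAtLeast_two_iff ⟨a, N + 1, ha⟩ (Nat.succ_pos N)).1 h'
    exact absurd (hno ⟨a, N + 1, ha⟩ (Nat.succ_pos N)) (not_le.2 hneg)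
  · intro hle win hN
    refine secondRayleigh_nonneg_of_encard_le_one ?_ win hN
    rw [hfin.encard_eq_coe_toFinset_card]
    exact_mod_cast hle

/-- PROVED: under RH no window carries a Galerkin negative direction of the even block of `ζ` (all levels
`εₖ^{(N)}(a) ≥ 0`). [folklore] -/
theorem not_galerkinNegIndexAtLeast_succ_of_riemannHypothesis (hRH : RiemannHypothesis) (n : ℕ) (win : Window) :
    ¬ GalerkinNegIndexAtLeast zetaDatum (n + 1) win := fun h ↦
  not_evenNegIndexAtLeast_succ_of_riemannHypothesis hRH n win.a (evenNegIndexAtLeast_of_galerkinNegIndexAtLeast h)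

end Summit.RiemannHypothesis.RiemannHypothesis.Theorems.PfPersistence
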